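import Mathlib
import HarnessLib
import Summits.QuantumFields.YangMills.Theorems.HypercubicLimit.Negative.ReflectedDensity
import Summits.QuantumFields.YangMills.Theorems.FradkinShenkerFlowFiniteSusceptibilityWeakCouplingRPCauchySchwarz
import Literature.MathematicalPhysics.AQFT.OSAxiomsSchwinger
import Literature.MathematicalPhysics.QuantumFieldTheory.OSData
import Literature.MathematicalPhysics.QuantumLattice.LatticeScalarField
import Literature.MathematicalPhysics.QuantumFieldTheory.LatticeGaugeStaticPotentialProofs
import Literature.Probability.LatticeModels.ThermodynamicLimit

/-!
# Block M-τ of line `conditional-mean-telescoping` (crux stmt-QuantumFields-8646): moment identity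
under torus translations

The centred torus moment of a plaquette string `(q k, x k, m k)` for Wilson's lattice gauge measure
on the torus of side `2L+1` is invariant under a simultaneous translation of all corners by
`v ∈ ℤ⁴`.

Proof: the torus plaquette `torusPlaquette r S i j y U` is read through the PERIODIC lift
`torusLift S U`, so it is the plaquette `(i, j)` of `U` at the projected torus site `proj S y`
(bridge `plaquetteHolonomyZd_torusLift'`); the plaquette at `proj S (y + v)` of the translated
configuration `torusConfigShift (proj S v) U` is the plaquette at `proj S y` of `U`
(`plaquetteHolonomy_torusConfigShift`, additivity of `proj`); Wilson's torus measure is invariant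
under the measurable equivalence `torusConfigShift (proj S v)` (tree,
`wilsonMeasure_map_torusConfigShift`); change variables (`integral_map_equiv`).
-/

noncomputable section

open scoped SchwartzMap ComplexConjugate
open MeasureTheory Filter Topology
open Literature.MathematicalPhysics.AQFT Literature.MathematicalPhysics.QuantumLattice
open Literature.MathematicalPhysics.QuantumFieldTheory
open Literature.Probability.LatticeModels (box Site)
open Summit.QuantumFields.YangMills.Theorems.HypercubicLimit.Negative (torusPlaquette thetaZ)

namespace Summit.QuantumFields.YangMills.Cruxes.HypercubicLimit.ConditionalMeanTelescoping

/-- (auxiliary, block M-τ) The projection `ℤ⁴ → (ℤ/Sℤ)⁴` is additive. [folklore] -/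
theorem mShift_proj_add (S : ℕ) (y v : Fin 4 → ℤ) :
    Literature.Probability.LatticeModels.Torus.proj S (y + v) =
      Literature.Probability.LatticeModels.Torus.proj S y +
        Literature.Probability.LatticeModels.Torus.proj S v := by
  funext l
  simp [Literature.Probability.LatticeModels.Torus.proj]

/-- (auxiliary, block M-τ) The torus plaquette at the translated corner `y + v` of the
configuration translated by `proj S v` is the torus plaquette at `y` of the original
configuration (periodic lift + `plaquetteHolonomy_torusConfigShift`). [folklore] -/
theorem mShift_torusPlaquette_torusConfigShift {G : Type} [Group G] [TopologicalSpace G]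
    [MeasurableSpace G] (r : LatticeRep G) (S : ℕ) (i j : Fin 4) (y v : Fin 4 → ℤ)
    (U : GaugeConfig 4 S G) :
    torusPlaquette r S i j (y + v)
        (torusConfigShift (Literature.Probability.LatticeModels.Torus.proj S v) U) =
      torusPlaquette r S i j y U := by
  unfold torusPlaquette plaquetteObs
  rw [Theorems.CurvatureBoostCovariance.Negative.plaquetteHolonomyZd_torusLift',
    Theorems.CurvatureBoostCovariance.Negative.plaquetteHolonomyZd_torusLift',
    plaquetteHolonomy_torusConfigShift, mShift_proj_add, add_sub_cancel_right]

/-- **Block M-τ (moment identity under torus translations).** The centred torus moment of a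
plaquette string is invariant under a simultaneous translation of all corners by `v ∈ ℤ⁴`
(translation invariance of Wilson's torus measure, periodic lift). [folklore] -/
theorem rpBlock_momentShift :
    ∀ (G : Type) [Group G] [TopologicalSpace G] [IsTopologicalGroup G] [CompactSpace G]
      [MeasurableSpace G] [BorelSpace G] (r : LatticeRep G) (β : ℝ) (L n : ℕ)
      (q : Fin n → Fin 4 × Fin 4) (m : Fin n → ℝ) (x : Fin n → (Fin 4 → ℤ)) (v : Fin 4 → ℤ),
        (∫ U, ∏ k, (torusPlaquette r (2 * L + 1) (q k).1 (q k).2 (x k + v) U - m k)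
            ∂(wilsonMeasure r.ρ β : Measure (GaugeConfig 4 (2 * L + 1) G))) =
          ∫ U, ∏ k, (torusPlaquette r (2 * L + 1) (q k).1 (q k).2 (x k) U - m k)
            ∂(wilsonMeasure r.ρ β : Measure (GaugeConfig 4 (2 * L + 1) G)) := by
  intro G _ _ _ _ _ _ r β L n q m x v
  haveI : NeZero (2 * L + 1) := ⟨by omega⟩
  have h := integral_map_equiv (μ := (wilsonMeasure r.ρ β : Measure (GaugeConfig 4 (2 * L + 1) G)))
    (torusConfigShift (Literature.Probability.LatticeModels.Torus.proj (2 * L + 1) v))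
    (fun U => ∏ k, (torusPlaquette r (2 * L + 1) (q k).1 (q k).2 (x k + v) U - m k))
  rw [wilsonMeasure_map_torusConfigShift r.ρ β _] at h
  rw [h]
  simp only [mShift_torusPlaquette_torusConfigShift]

end Summit.QuantumFields.YangMills.Cruxes.HypercubicLimit.ConditionalMeanTelescoping

end
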